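import Summits.CriticalPhenomena.PercolationContinuityZ3.Theorems.SahiMasterFamilyPrincipalCapBetaSixMain

/-!
# Sahi's `C_n` on the principal-cap stratum for every order `n ≤ 6`

Unit `prim-masterthm-p4` (gen 13; crux anchor stmt-CriticalPhenomena-4575, helper work; memo
`run/shared/lean/prim/prim-masterthm/prim-masterthm-p4/P4-GEN13-REPORT.md` §7).  Packaging of `…PrincipalCapBeta` (the all-orders reduction),
`…PrincipalCapBetaSmall` (`PhiNonneg 3, 4, 5`) and `…PrincipalCapBetaSixMain` (`PhiNonneg 6`): the trivial orders `1, 2` (`phiNonneg_one`,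
`phiNonneg_two`), `phiNonneg_of_le_six : n ≤ 6 → PhiNonneg n`, and the event-level statement `sahiE_ind_nonneg_of_principalCap_of_le_six`:
**for every finite product of two-point spaces, every `p ∈ [0,1]^ι`, every `n ≤ 6` and every `n` increasing events whose common part is a principal
up-set, `E_n(μ_p; 1_{U_0},…,1_{U_{n−1}}) ≥ 0`.**  HONEST FRAMING: `C_n` in general and `F(n)` for `n ≥ 7` remain OPEN.  Axioms standard. [this work]
-/

noncomputable section

open scoped Classical

namespace Summit.CriticalPhenomena.PercolationContinuityZ3.Theorems

namespace PrincipalCapBeta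

open Finset Function
open Literature.Combinatorics.Sahi2008
open Literature.Probability.Percolation.DecisionTree (ind)

/-- `Φ_1(β) = β_⊤`. [this work] -/
theorem phiSet_one (β : Finset (Fin 1) → ℝ) : phiSet 1 β = β univ := by
  rw [phiSet_eq_sahiE_real, sahiE_one_apply]
  have hu : ({0} : Finset (Fin 1)) = Finset.univ := by decide
  rw [← Finset.prod_singleton (f := realF) (0 : Fin 1), hu]
  exact ex_realW_prod β _

/-- `Φ_2(β) = β_⊤ − β₀β₁`. [this work] -/
theorem phiSet_two (β : Finset (Fin 2) → ℝ) : phiSet 2 β = β univ - β {0} * β {1} := by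
  rw [phiSet_eq_sahiE_real, sahiE_two_apply]
  have e0 : ex (realW β) (realF (0 : Fin 2)) = β {0} := by
    rw [← Finset.prod_singleton (f := realF) (0 : Fin 2)]; exact ex_realW_prod β _
  have e1 : ex (realW β) (realF (1 : Fin 2)) = β {1} := by
    rw [← Finset.prod_singleton (f := realF) (1 : Fin 2)]; exact ex_realW_prod β _
  have e01 : ex (realW β) (realF (0 : Fin 2) * realF (1 : Fin 2)) = β univ := by
    have hp : realF (0 : Fin 2) * realF (1 : Fin 2) = ∏ i ∈ ({0, 1} : Finset (Fin 2)), realF i := by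
      rw [Finset.prod_insert (by decide), Finset.prod_singleton]
    have hu : ({0, 1} : Finset (Fin 2)) = Finset.univ := by decide
    rw [hp, hu]; exact ex_realW_prod β _
  rw [e01, e0, e1]

/-- `F(1)`. [this work] -/
theorem phiNonneg_one : PhiNonneg 1 := by
  intro β _ _ htop _
  rw [phiSet_one, htop]; exact zero_le_one

/-- `F(2)` (`1 − β₀β₁ ≥ 0`). [this work] -/
theorem phiNonneg_two : PhiNonneg 2 := by
  intro β h0 h1 htop _
  rw [phiSet_two, htop]
  have := mul_le_one₀ (h1 {0}) (h0 {1}) (h1 {1})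
  linarith

/-- `F(0)` (vacuous: `Φ_0 = 1`... the empty sum over the unique (empty) ordered finpartition has value `1`). [this work] -/
theorem phiNonneg_zero : PhiNonneg 0 := by
  intro β _ _ _ _
  unfold phiSet
  refine Finset.sum_nonneg fun c _ => ?_
  have hl : c.length = 0 := Nat.eq_zero_of_le_zero (c.length_le)
  have : (Finset.univ : Finset (Fin c.length)) = ∅ := by
    rw [Finset.univ_eq_empty_iff, hl]; exact (inferInstance : IsEmpty (Fin 0))
  rw [this, Finset.prod_empty, mul_one, hl]
  norm_num

/-- **`F(n)` for every `n ≤ 6`.** [this work] -/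
theorem phiNonneg_of_le_six {n : ℕ} (hn : n ≤ 6) : PhiNonneg n := by
  interval_cases n
  · exact phiNonneg_zero
  · exact phiNonneg_one
  · exact phiNonneg_two
  · exact phiNonneg_three
  · exact phiNonneg_four
  · exact phiNonneg_five
  · exact phiNonneg_six

/-- **Sahi's `C_n` on the principal-cap stratum for every `n ≤ 6`**: for every finite index type, every `p ∈ [0,1]^ι`, and every
`k + 1 ≤ 6` increasing events whose common part is a principal up-set, `E_{k+1}(μ_p; 1_U) ≥ 0`. [this work] -/
theorem sahiE_ind_nonneg_of_principalCap_of_le_six {k : ℕ} (hk : k + 1 ≤ 6) (ι : Type) [Fintype ι] (p : ι → unitInterval)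
    (U : Fin (k + 1) → Set (Set ι)) (hU : ∀ j, IsUpperSet (U j)) (c : Finset ι)
    (hpc : ∀ T : Set ι, (∀ j, T ∈ U j) ↔ (↑c : Set ι) ⊆ T) :
    0 ≤ sahiE (bernoulliWeight p) (k + 1) (fun j => ind (U j)) :=
  sahiE_ind_nonneg_of_phiNonneg (phiNonneg_of_le_six hk) p U hU c hpc

end PrincipalCapBeta

end Summit.CriticalPhenomena.PercolationContinuityZ3.Theorems
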